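import Summits.CriticalPhenomena.Ising3DConformalLimit.Theses.InverseSquareTelemetry
import Summits.CriticalPhenomena.Ising3DConformalLimit.Theorems.PrecisionLaplacianMoebiusLimitOfTwoPointLawDyadicReduction
import Summits.CriticalPhenomena.Ising3DConformalLimit.Theorems.PrecisionLaplacianMoebiusLimitOfTwoPointLawDyadicStubEdges
import Summits.CriticalPhenomena.Ising3DConformalLimit.Theorems.PrecisionLaplacianMoebiusLimitOfTwoPointLawLimitExistsEdge
import HarnessLib

/-!
# Stub `stub_dyadicInversion` (I₂) of crux `InverseSquareTelemetry.TwoPointSpineComplement`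
# (item stmt-CriticalPhenomena-4497, line `registered`): its payers among the OPEN items, by name
# (`--supports stmt-CriticalPhenomena-4497`; edges only, the stub itself is NOT proved here)

The stub I₂ says: for every witness `(Δ, c)` of the two-point law `⟨σ₀σ_x⟩_{β_c(3)}·|x|₂^{2Δ} → c > 0`,
EVERY dyadic canonical limit `Tₙ` (even `n ≥ 4`) of `2^{knΔ}⟨σ_{[2^k x₁]}⋯σ_{[2^k xₙ]}⟩_{β_c}` on
`NonCoincident 3 n` is covariant under the unit inversion `ι = EuclideanGeometry.inversion 0 1` with weight
`Δ` off the origin. This is the conformal-(inversion-)covariance content of the critical `ℤ³` Ising scaling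
limit — an open problem (Duminil-Copin, ICM 2022, §8.4). The tree already records `crux 4801 → I₂`
(`dyadicInversion_of_moebiusLimitOfTwoPointLaw`) and `1344 → I₂` (`stub_dyadicInversion_of_moebiusLimitExists`).

Because I₂ CARRIES a witness of item 0634 (`IsingEuclidUpgradeR2RotInvPowerLaw`), every landed sufficient
package for crux 4801 pays I₂ with its existence factor weakened to the conditional `0634 → 4738`:

* `stub_dyadicInversion_of_limitExists_of_multipole` —
  **`(0634 → 4738) → 5352 → 5353 → I₂`** (Ward route of `PrimaryAtInfinity`: bare existence
  `WeylWindow.LimitExists`, `FirstMultipoleIdentity`, `FarFieldClustering`; the analysis items 5356/5357 are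
  theorems, regularity is free, `NonSaturation` is not needed — `moebiusLimitOfTwoPointLaw_of_limitExists`);
* `stub_dyadicInversion_of_limitExists_of_bare₂` —
  **`(0634 → 4738) → 8367 → 1982 → I₂`** (bare route: `RotationUpgradeFromTwoPoint`, `InversionUpgradeNormalised`;
  `moebiusLimitOfTwoPointLaw_of_bare₂`);
* `stub_dyadicInversion_of_limitExists_of_bare` —
  **`(0634 → 4738) → 1980 → 1982 → I₂`** (`LimitRotationInvariant` in place of 8367; `moebiusLimitOfTwoPointLaw_of_bare`);
* `stub_dyadicInversion_of_moebiusLimitExists_of_twoPointLaw` — **`(0634 → 1344) → I₂`**, i.e. `crux 4801 → I₂`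
  read through `MoebiusLimitOfTwoPointLaw ↔ (0634 → 1344)` (`Iff.rfl`).

The two-point law itself cannot discharge 5352/5353 (they quantify the far field of `S_{n+2}` for every `n`,
while the law pins `S₂` only: `twoPoint_of_limit`), nor 4738 (I₂ is given ONE arity along ONE mesh sequence).
No definitions, no `sorry`; pure composition of landed edges.
-/

noncomputable section

namespace Summit.CriticalPhenomena.Ising3DConformalLimit.InverseSquareTelemetryTwoPointSpineComplement.DyadicInversion

open Literature.Probability.LatticeModels Filter Topology EuclideanGeometry
open Summit.CriticalPhenomena.Ising3DConformalLimit.Theses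
open Summit.CriticalPhenomena.Ising3DConformalLimit.PrecisionLaplacianMoebiusLimitOfTwoPointLaw
  (dyadicInversion_of_moebiusLimitOfTwoPointLaw moebiusLimitOfTwoPointLaw_of_limitExists
    moebiusLimitOfTwoPointLaw_of_bare moebiusLimitOfTwoPointLaw_of_bare₂
    moebiusLimitOfTwoPointLaw_of_moebiusLimitExists)

/-- **`(0634 → 1344) → I₂`.** If the two-point law (item 0634) implies the existence of a non-degenerate
Möbius-covariant pointwise scaling limit (item 1344 `PerfectScreening.MoebiusLimitExists`) — which is crux 4801
`PrecisionLaplacian.MoebiusLimitOfTwoPointLaw` verbatim — then every dyadic canonical limit of an even arity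
`n ≥ 4` is unit-inversion covariant with the weight `Δ` of the law (uniqueness of pointwise limits and
`scalingDimension` rigidity, inside `dyadicInversion_of_moebiusLimitOfTwoPointLaw`). -/
theorem stub_dyadicInversion_of_moebiusLimitExists_of_twoPointLaw
    (h : IsingEuclidUpgrade.IsingEuclidUpgradeR2RotInvPowerLaw → PerfectScreening.MoebiusLimitExists) :
    ∀ Δ c : ℝ, 0 < c →
      Tendsto (fun x : Site 3 =>
        criticalTwoPoint 3 x * Real.sqrt (∑ i, ((x i : ℝ)) ^ 2) ^ (2 * Δ)) cofinite (nhds c) →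
      ∀ n, 4 ≤ n → Even n → ∀ Tn : (Fin n → EuclideanSpace ℝ (Fin 3)) → ℝ,
        TendstoLocallyUniformlyOn
          (fun k : ℕ => rescaledCorrelator (criticalCorr 3) (fun δ => δ ^ (-Δ)) n (((2:ℝ) ^ k)⁻¹))
          Tn atTop (NonCoincident 3 n) →
        ∀ x ∈ NonCoincident 3 n, (∀ i, x i ≠ 0) →
          Tn (fun i => inversion 0 1 (x i)) = (∏ i, ‖x i‖ ^ (2 * Δ)) * Tn x :=
  dyadicInversion_of_moebiusLimitOfTwoPointLaw h

/-- **`(0634 → 4738) → 5352 → 5353 → I₂`** (the Ward route). Bare existence of a non-degenerate pointwise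
scaling limit under the two-point law (`WeylWindow.LimitExists`, item 4738, asked only conditionally on item
0634, which every witness `(Δ, c)` of the law supplies), the first-multipole identity at infinity
(`PrimaryAtInfinity.FirstMultipoleIdentity`, item 5352) and far-field monopole/dipole clustering
(`PrimaryAtInfinity.FarFieldClustering`, item 5353) give crux 4801 (`moebiusLimitOfTwoPointLaw_of_limitExists`:
regularity of the limit is free, items 5356/5357 are theorems, `NonSaturation` is not needed), hence I₂. -/
theorem dyadicInversion_of_limitExists_of_multipole
    (hLE : IsingEuclidUpgrade.IsingEuclidUpgradeR2RotInvPowerLaw → WeylWindow.LimitExists)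
    (hM1 : PrimaryAtInfinity.FirstMultipoleIdentity) (hFC : PrimaryAtInfinity.FarFieldClustering) :
    ∀ Δ c : ℝ, 0 < c →
      Tendsto (fun x : Site 3 =>
        criticalTwoPoint 3 x * Real.sqrt (∑ i, ((x i : ℝ)) ^ 2) ^ (2 * Δ)) cofinite (nhds c) →
      ∀ n, 4 ≤ n → Even n → ∀ Tn : (Fin n → EuclideanSpace ℝ (Fin 3)) → ℝ,
        TendstoLocallyUniformlyOn
          (fun k : ℕ => rescaledCorrelator (criticalCorr 3) (fun δ => δ ^ (-Δ)) n (((2:ℝ) ^ k)⁻¹))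
          Tn atTop (NonCoincident 3 n) →
        ∀ x ∈ NonCoincident 3 n, (∀ i, x i ≠ 0) →
          Tn (fun i => inversion 0 1 (x i)) = (∏ i, ‖x i‖ ^ (2 * Δ)) * Tn x :=
  stub_dyadicInversion_of_moebiusLimitExists_of_twoPointLaw fun hP =>
    moebiusLimitOfTwoPointLaw_of_limitExists (hLE hP) hM1 hFC hP

/-- **`(0634 → 4738) → 8367 → 1982 → I₂`** (the bare route, sharpest `O(3)` factor). Conditional bare
existence (item 4738 under item 0634), the `n`-point rotation upgrade from two-point isotropy
(`GaussianScaleMixture.RotationUpgradeFromTwoPoint`, item 8367) and the inversion upgrade for normalised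
Euclidean scale-covariant limits (`HyperoctahedralRP.InversionUpgradeNormalised`, item 1982) give crux 4801
(`moebiusLimitOfTwoPointLaw_of_bare₂`), hence I₂. -/
theorem stub_dyadicInversion_of_limitExists_of_bare₂
    (hLE : IsingEuclidUpgrade.IsingEuclidUpgradeR2RotInvPowerLaw → WeylWindow.LimitExists)
    (h8367 : GaussianScaleMixture.RotationUpgradeFromTwoPoint)
    (h1982 : HyperoctahedralRP.InversionUpgradeNormalised) :
    ∀ Δ c : ℝ, 0 < c →
      Tendsto (fun x : Site 3 =>
        criticalTwoPoint 3 x * Real.sqrt (∑ i, ((x i : ℝ)) ^ 2) ^ (2 * Δ)) cofinite (nhds c) →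
      ∀ n, 4 ≤ n → Even n → ∀ Tn : (Fin n → EuclideanSpace ℝ (Fin 3)) → ℝ,
        TendstoLocallyUniformlyOn
          (fun k : ℕ => rescaledCorrelator (criticalCorr 3) (fun δ => δ ^ (-Δ)) n (((2:ℝ) ^ k)⁻¹))
          Tn atTop (NonCoincident 3 n) →
        ∀ x ∈ NonCoincident 3 n, (∀ i, x i ≠ 0) →
          Tn (fun i => inversion 0 1 (x i)) = (∏ i, ‖x i‖ ^ (2 * Δ)) * Tn x :=
  stub_dyadicInversion_of_moebiusLimitExists_of_twoPointLaw fun hP =>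
    moebiusLimitOfTwoPointLaw_of_bare₂ (hLE hP) h8367 h1982 hP

/-- **`(0634 → 4738) → 1980 → 1982 → I₂`** (the bare route with the rotation item of route
`HyperoctahedralRP`). Conditional bare existence (item 4738 under item 0634), `O(3)` invariance of the
normalised scale-covariant limits (`HyperoctahedralRP.LimitRotationInvariant`, item 1980) and the inversion
upgrade (`HyperoctahedralRP.InversionUpgradeNormalised`, item 1982) give crux 4801
(`moebiusLimitOfTwoPointLaw_of_bare`), hence I₂. -/
theorem stub_dyadicInversion_of_limitExists_of_bare
    (hLE : IsingEuclidUpgrade.IsingEuclidUpgradeR2RotInvPowerLaw → WeylWindow.LimitExists)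
    (h1980 : HyperoctahedralRP.LimitRotationInvariant)
    (h1982 : HyperoctahedralRP.InversionUpgradeNormalised) :
    ∀ Δ c : ℝ, 0 < c →
      Tendsto (fun x : Site 3 =>
        criticalTwoPoint 3 x * Real.sqrt (∑ i, ((x i : ℝ)) ^ 2) ^ (2 * Δ)) cofinite (nhds c) →
      ∀ n, 4 ≤ n → Even n → ∀ Tn : (Fin n → EuclideanSpace ℝ (Fin 3)) → ℝ,
        TendstoLocallyUniformlyOn
          (fun k : ℕ => rescaledCorrelator (criticalCorr 3) (fun δ => δ ^ (-Δ)) n (((2:ℝ) ^ k)⁻¹))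
          Tn atTop (NonCoincident 3 n) →
        ∀ x ∈ NonCoincident 3 n, (∀ i, x i ≠ 0) →
          Tn (fun i => inversion 0 1 (x i)) = (∏ i, ‖x i‖ ^ (2 * Δ)) * Tn x :=
  stub_dyadicInversion_of_moebiusLimitExists_of_twoPointLaw fun hP =>
    moebiusLimitOfTwoPointLaw_of_bare (hLE hP) h1980 h1982 hP

/-- **Unconditional-existence form of the Ward edge: `4738 → 5352 → 5353 → I₂`** (items
`WeylWindow.LimitExists`, `PrimaryAtInfinity.FirstMultipoleIdentity`, `PrimaryAtInfinity.FarFieldClustering`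
outright) — the literal composite `dyadicInversion_of_moebiusLimitOfTwoPointLaw ∘ moebiusLimitOfTwoPointLaw_of_limitExists`. -/
theorem stub_dyadicInversion_of_limitExists_of_multipole'
    (hL : WeylWindow.LimitExists) (hM1 : PrimaryAtInfinity.FirstMultipoleIdentity)
    (hFC : PrimaryAtInfinity.FarFieldClustering) :
    ∀ Δ c : ℝ, 0 < c →
      Tendsto (fun x : Site 3 =>
        criticalTwoPoint 3 x * Real.sqrt (∑ i, ((x i : ℝ)) ^ 2) ^ (2 * Δ)) cofinite (nhds c) →
      ∀ n, 4 ≤ n → Even n → ∀ Tn : (Fin n → EuclideanSpace ℝ (Fin 3)) → ℝ,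
        TendstoLocallyUniformlyOn
          (fun k : ℕ => rescaledCorrelator (criticalCorr 3) (fun δ => δ ^ (-Δ)) n (((2:ℝ) ^ k)⁻¹))
          Tn atTop (NonCoincident 3 n) →
        ∀ x ∈ NonCoincident 3 n, (∀ i, x i ≠ 0) →
          Tn (fun i => inversion 0 1 (x i)) = (∏ i, ‖x i‖ ^ (2 * Δ)) * Tn x :=
  dyadicInversion_of_limitExists_of_multipole (fun _ => hL) hM1 hFC

/-- **Registered bookkeeping form of the Ward edge `(0634 → 4738) → 5352 → 5353 → I₂`** (header written fully
qualified on one line: it is the registered edge stub of this `--supports` file; proof = the binder form above). -/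
theorem stub_dyadicInversion_of_limitExists_of_multipole : (Summit.CriticalPhenomena.Ising3DConformalLimit.Theses.IsingEuclidUpgrade.IsingEuclidUpgradeR2RotInvPowerLaw → Summit.CriticalPhenomena.Ising3DConformalLimit.Theses.WeylWindow.LimitExists) → Summit.CriticalPhenomena.Ising3DConformalLimit.Theses.PrimaryAtInfinity.FirstMultipoleIdentity → Summit.CriticalPhenomena.Ising3DConformalLimit.Theses.PrimaryAtInfinity.FarFieldClustering → ∀ Δ c : ℝ, 0 < c → Filter.Tendsto (fun x : Literature.Probability.LatticeModels.Site 3 => Literature.Probability.LatticeModels.criticalTwoPoint 3 x * Real.sqrt (∑ i, ((x i : ℝ)) ^ 2) ^ (2 * Δ)) Filter.cofinite (nhds c) → ∀ n, 4 ≤ n → Even n → ∀ Tn : (Fin n → EuclideanSpace ℝ (Fin 3)) → ℝ, TendstoLocallyUniformlyOn (fun k : ℕ => Literature.Probability.LatticeModels.rescaledCorrelator (Literature.Probability.LatticeModels.criticalCorr 3) (fun δ => δ ^ (-Δ)) n (((2:ℝ) ^ k)⁻¹)) Tn Filter.atTop (Literature.Probability.LatticeModels.NonCoincident 3 n) → ∀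 x ∈ Literature.Probability.LatticeModels.NonCoincident 3 n, (∀ i, x i ≠ 0) → Tn (fun i => EuclideanGeometry.inversion 0 1 (x i)) = (∏ i, ‖x i‖ ^ (2 * Δ)) * Tn x :=
  fun hLE hM1 hFC => dyadicInversion_of_limitExists_of_multipole hLE hM1 hFC

end Summit.CriticalPhenomena.Ising3DConformalLimit.InverseSquareTelemetryTwoPointSpineComplement.DyadicInversion

end
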